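import Summits.CriticalPhenomena.CardyFormulaZ2.Theses.CardyTensorRG

/-!
# Assembly of route `CardyTensorRG` (sub-problem `CardyFormulaZ2`)

Item `stmt-CriticalPhenomena-14629`: the assembly statement
`PolyominoGaussianLaw → PolyominoToJordan → CardyRigidity → CardyFormulaZ2` of the route
`route-CriticalPhenomena-CardyTensorRG` (route-choice split, rev 6/7).  It is exactly the
implication recorded by the route's crux-only deciding theorem `CardyTensorRG.closes`
(one exponent `a ∈ (0,1)` with the Coulomb-gas law `I_a` on polyomino conformal rectangles;
`I_a` is continuous on `(0,1)`, so the Jordan extension gives the law on every conformal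
rectangle; Cardy rigidity identifies `I_a = cardyFunction` on `(0,1)`, where all cross-ratios
of uniformizing data live), so the proof is modus ponens through `closes`.  All mathematical
content sits in the three hypotheses; nothing is assumed here.
-/

namespace Summit.CriticalPhenomena.CardyFormulaZ2.Theorems

open Summit.CriticalPhenomena.CardyFormulaZ2.Theses

/-- **Assembly of the `CardyTensorRG` route** (item `stmt-CriticalPhenomena-14629`):
the three route hypotheses `PolyominoGaussianLaw` (one-exponent Coulomb-gas crossing law on
polyomino conformal rectangles), `PolyominoToJordan` (extension of any limit law continuous on
`(0,1)` from polyomino to all conformal rectangles) and `CardyRigidity` (a limit law of all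
conformal rectangles equals `cardyFunction` on `(0,1)`) imply `CardyFormulaZ2` — the same
implication as the route's deciding theorem `CardyTensorRG.closes`, applied verbatim. -/
theorem cardyTensorRG_assembly_proof : CardyTensorRG.Assembly := by
  unfold CardyTensorRG.Assembly
  intro hP hJ hR
  exact CardyTensorRG.closes hP hJ hR

end Summit.CriticalPhenomena.CardyFormulaZ2.Theorems
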